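import Summits.ResolutionOfSingularities.ResolutionOfSingularities.Theorems.UniversalCellsMatroidCellResResidueWitness
import HarnessLib

/-!
# A singular CLOSED point of the witness chart — the residue stub (N′) is not vacuous (crux `UniversalCells.MatroidCellRes`)

Sixth witness file for crux item stmt-ResolutionOfSingularities-15230 (`UniversalCells.MatroidCellRes`,
line `birth`). RESHAPE 4e of the line (`Cruxes/MatroidCellRes/Lines/birth.lean`) weakened the residue
stub to (N′) `stub_singularClosedPointLocalRes`: local resolution at a SINGULAR CLOSED point `w` of a
saturated integral principal chart `Spec (Q_Γ)_g`, of dimension `≥ 2`, of a non-integral Γ-scheme.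
`…ResidueWitness.lean` showed that the hypotheses of the old residue (N) are satisfiable (the
complete quadrilateral, `p ≠ 2`); here the extra data of (N′) is supplied on the same chart: a
CLOSED point with NON-regular local ring — the vertex `y = (1, 0, …, 0)` of the quadric cone
`(K[y₀,…,y₆] ⧸ (y₃y₆ - y₄y₅))[1/y₀] ≅ (Q_Γ)_{a₀₀}`:

* `exists_isMaximal_not_isRegularLocalRing_cone_away` — the kernel of evaluation at the vertex is a
  maximal ideal of the cone chart whose localisation is not regular (Jacobian criterion,
  `not_isRegularLocalRing_localization_of_pderiv_eval_eq_zero`, as in `not_isRegularRing_cone_away`);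
* `exists_isMaximal_not_isRegularLocalRing_of_ringEquiv` — transport along the ring isomorphism
  chart `≅` cone (`nonempty_ringEquiv_chart_cone`);
* `not_isRegularLocalRing_stalk_Spec` — the stalk of `Spec R` at `w` is `R_w` (`Spec.stalkIso`), and a
  maximal ideal is a closed point (`PrimeSpectrum.isClosed_singleton_iff_isMaximal`);
* `stub_singularClosedPointLocalRes_hypotheses_satisfiable` — the conjunction of ALL hypotheses of
  (N′) in the stub's own vocabulary, at `p = 3`, `m = 4`.

No definition and no notation is declared. Folklore throughout.
-/

noncomputable section

-- single-problem summit: the doubled namespace component `ResolutionOfSingularities` is forced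
set_option linter.dupNamespace false

open MvPolynomial AlgebraicGeometry Literature.AlgebraicGeometry.Resolution

namespace Summit.ResolutionOfSingularities.ResolutionOfSingularities.Theorems.MatroidCellRes

variable {K : Type} [Field K]

/-! ## The vertex of the cone chart -/

/-- **The vertex of the cone chart is a singular closed point**: in
`D = (K[y₀,…,y₆] ⧸ (y₃y₆ - y₄y₅))[1/y₀]` the kernel of evaluation at `y = (1, 0, …, 0)` is a
maximal ideal whose local ring `D_𝔪` is not regular (it is the local ring of the hypersurface
`y₃y₆ = y₄y₅` at a point where the equation and all its partials vanish).
[cite: Hartshorne1977, I Thm. 5.1] -/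
theorem exists_isMaximal_not_isRegularLocalRing_cone_away :
    ∃ w : PrimeSpectrum (Localization.Away (Ideal.Quotient.mk
      (Ideal.span {(X 3 * X 6 - X 4 * X 5 : MvPolynomial (Fin 7) K)}) (X 0))),
      w.asIdeal.IsMaximal ∧ ¬ IsRegularLocalRing (Localization.AtPrime w.asIdeal) := by
  -- names
  set q : MvPolynomial (Fin 7) K := X 3 * X 6 - X 4 * X 5 with hq
  set s : Fin 7 → K := Pi.single 0 1 with hs
  haveI := isDomain_cone (K := K)
  -- evaluation at the vertex, through the quotient and the localisation
  have hqs : eval s q = 0 := by simp [hq, hs, eval_X]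
  have hker : ∀ a ∈ Ideal.span {q}, eval s a = 0 := by
    intro a ha
    rw [Ideal.mem_span_singleton] at ha
    obtain ⟨c, rfl⟩ := ha
    rw [map_mul, hqs, zero_mul]
  set evA : MvPolynomial (Fin 7) K ⧸ Ideal.span {q} →+* K := Ideal.Quotient.lift _ (eval s) hker
    with hevA
  have hevA_mk : ∀ a, evA (Ideal.Quotient.mk _ a) = eval s a := fun a =>
    Ideal.Quotient.lift_mk _ _ hker
  have hunit : IsUnit (evA (Ideal.Quotient.mk (Ideal.span {q}) (X 0))) := by
    rw [hevA_mk, eval_X, hs]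
    simp
  set evD : Localization.Away (Ideal.Quotient.mk (Ideal.span {q}) (X 0)) →+* K :=
    IsLocalization.Away.lift _ hunit with hevD
  have hevD_alg : ∀ a, evD (algebraMap _ _ (Ideal.Quotient.mk _ a)) = eval s a := fun a => by
    rw [hevD, IsLocalization.Away.lift_eq, hevA_mk]
  -- `evD` is onto the field `K`, so its kernel is a maximal ideal
  have hsurj : Function.Surjective evD := fun c =>
    ⟨algebraMap _ _ (Ideal.Quotient.mk _ (C c)), by rw [hevD_alg, eval_C]⟩
  -- the point as a prime of the localisation, and its contraction to the cone ring
  haveI hP'prime : (RingHom.ker evD).IsPrime := RingHom.ker_isPrime evD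
  haveI hPprime : ((RingHom.ker evD).comap (algebraMap (MvPolynomial (Fin 7) K ⧸ Ideal.span {q})
      (Localization.Away (Ideal.Quotient.mk (Ideal.span {q}) (X 0))))).IsPrime :=
    Ideal.comap_isPrime _ _
  have hPker : (RingHom.ker evD).comap (algebraMap (MvPolynomial (Fin 7) K ⧸ Ideal.span {q})
      (Localization.Away (Ideal.Quotient.mk (Ideal.span {q}) (X 0)))) = RingHom.ker evA := by
    rw [RingHom.comap_ker]
    congr 1
    refine Ideal.Quotient.ringHom_ext (RingHom.ext fun a => ?_)
    show evD (algebraMap _ _ (Ideal.Quotient.mk _ a)) = evA (Ideal.Quotient.mk _ a)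
    rw [hevD, IsLocalization.Away.lift_eq]
  have hPcomap : ((RingHom.ker evD).comap (algebraMap (MvPolynomial (Fin 7) K ⧸ Ideal.span {q})
      (Localization.Away (Ideal.Quotient.mk (Ideal.span {q}) (X 0))))).comap
        (Ideal.Quotient.mk (Ideal.span {q})) = RingHom.ker (eval s) := by
    rw [hPker, RingHom.comap_ker]
    congr 1
  -- Jacobian criterion at the vertex: the hypersurface local ring is not regular
  have hq0 : q ≠ 0 := prime_cone.ne_zero
  have hpd : ∀ i, eval s (pderiv i q) = 0 := by
    intro i
    fin_cases i <;> simp [hq, hs, eval_X, pderiv_X]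
  have hnot := not_isRegularLocalRing_localization_of_pderiv_eval_eq_zero s hq0 hqs hpd
    ((RingHom.ker evD).comap (algebraMap (MvPolynomial (Fin 7) K ⧸ Ideal.span {q})
      (Localization.Away (Ideal.Quotient.mk (Ideal.span {q}) (X 0))))) hPcomap
  -- that local ring is the localisation of `D` at the point
  have e : Localization.AtPrime (RingHom.ker evD) ≃+*
      Localization.AtPrime ((RingHom.ker evD).comap (algebraMap
        (MvPolynomial (Fin 7) K ⧸ Ideal.span {q})
        (Localization.Away (Ideal.Quotient.mk (Ideal.span {q}) (X 0))))) :=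
    (IsLocalization.localizationLocalizationAtPrimeIsoLocalization
      (Submonoid.powers (Ideal.Quotient.mk (Ideal.span {q}) (X 0)))
      (RingHom.ker evD)).symm.toRingEquiv
  refine ⟨⟨RingHom.ker evD, hP'prime⟩, RingHom.ker_isMaximal_of_surjective evD hsurj, fun h => ?_⟩
  haveI : IsRegularLocalRing (Localization.AtPrime (RingHom.ker evD)) := h
  exact hnot (IsRegularLocalRing.of_ringEquiv e)

/-! ## Transport: ring isomorphisms, stalks of affine schemes -/

/-- A ring isomorphism `A ≃+* B` carries a maximal ideal of `B` with non-regular local ring to one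
of `A` (contraction; the local rings are isomorphic). [folklore] -/
theorem exists_isMaximal_not_isRegularLocalRing_of_ringEquiv {A B : Type*} [CommRing A]
    [CommRing B] (e : A ≃+* B)
    (h : ∃ w : PrimeSpectrum B, w.asIdeal.IsMaximal ∧
      ¬ IsRegularLocalRing (Localization.AtPrime w.asIdeal)) :
    ∃ w : PrimeSpectrum A, w.asIdeal.IsMaximal ∧
      ¬ IsRegularLocalRing (Localization.AtPrime w.asIdeal) := by
  obtain ⟨w, hmax, hnot⟩ := h
  haveI := hmax
  refine ⟨⟨w.asIdeal.comap e, Ideal.comap_isPrime e w.asIdeal⟩,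
    Ideal.comap_isMaximal_of_surjective e e.surjective, fun hreg => ?_⟩
  haveI : IsRegularLocalRing (Localization.AtPrime (w.asIdeal.comap e)) := hreg
  exact hnot (IsRegularLocalRing.of_ringEquiv
    (IsLocalization.ringEquivOfRingEquiv (Localization.AtPrime (w.asIdeal.comap e))
      (Localization.AtPrime w.asIdeal) e (e.map_primeCompl_comap_eq w.asIdeal)))

/-- The stalk of `Spec R` at `w` is the localisation `R_w` (`Spec.stalkIso`), so it is regular
only if `R_w` is. [folklore] -/
theorem not_isRegularLocalRing_stalk_Spec {R : Type} [CommRing R] (w : PrimeSpectrum R)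
    (h : ¬ IsRegularLocalRing (Localization.AtPrime w.asIdeal)) :
    ¬ IsRegularLocalRing ((Spec (.of R)).presheaf.stalk (w : ↑(Spec (.of R)))) := fun hreg => by
  haveI := hreg
  exact h (IsRegularLocalRing.of_ringEquiv (Spec.stalkIso (.of R) w).commRingCatIsoToRingEquiv)

/-! ## The chart -/

/-- **The witness chart has a singular closed point** (`p ≠ 2`): the chart ring
`(Q_Γ)_{a₀₀}` of the complete quadrilateral is isomorphic to the cone chart, whose vertex is a
maximal ideal with non-regular local ring. [cite: Hartshorne1977, I Thm. 5.1] -/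
theorem exists_isMaximal_not_isRegularLocalRing_chart (h2 : (2 : K) ≠ 0) :
    ∃ w : PrimeSpectrum (Localization.Away (Ideal.Quotient.mk (HuGamma.ideal K 4
        {u | aeval (fun ij : Fin 3 × Fin 4 =>
        (![![(1 : K), 1, 1, 0], ![1, 1, 0, 1], ![1, 0, 1, 1]] : Fin 3 → Fin 4 → K) ij.1 ij.2)
          (HuGamma.minor K 4 u) = 0}) (X (0, 0)))),
      w.asIdeal.IsMaximal ∧ ¬ IsRegularLocalRing (Localization.AtPrime w.asIdeal) := by
  obtain ⟨e⟩ := nonempty_ringEquiv_chart_cone (K := K) h2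
  exact exists_isMaximal_not_isRegularLocalRing_of_ringEquiv e
    exists_isMaximal_not_isRegularLocalRing_cone_away

/-- **The residue stub (N′) is not vacuous** — the conjunction of ALL hypotheses of the registered
stub `stub_singularClosedPointLocalRes` of line `birth` (crux `MatroidCellRes`, RESHAPE 4e), in its
own vocabulary: at `p = 3`, `m = 4`, `Γ = {u | x_u(A₀) = 0}` for the complete quadrilateral `A₀`,
`g = a₀₀`, and `w` the vertex of the cone: `Q_Γ` is not a domain, `(Q_Γ)_g` is a domain on which
`Γ` is saturated, of dimension `> 1`, and `w` is a CLOSED point of `Spec (Q_Γ)_g` whose local ring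
is NOT regular. [folklore] -/
theorem stub_singularClosedPointLocalRes_hypotheses_satisfiable :
    ∃ (p : ℕ) (_ : p.Prime) (m : ℕ) (Γ : Set (Fin 3 → Fin 3 ⊕ Fin m))
      (g : MvPolynomial (Fin 3 × Fin m) (ZMod p) ⧸ Ideal.span ((fun u : Fin 3 → Fin 3 ⊕ Fin m => ((Matrix.fromCols (1 : Matrix (Fin 3) (Fin 3) (MvPolynomial (Fin 3 × Fin m) (ZMod p))) (Matrix.of fun i j => MvPolynomial.X (i, j))).submatrix id u).det) '' Γ))
      (w : Spec (.of (Localization.Away g))),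
      ¬ IsDomain (MvPolynomial (Fin 3 × Fin m) (ZMod p) ⧸ Ideal.span ((fun u : Fin 3 → Fin 3 ⊕ Fin m => ((Matrix.fromCols (1 : Matrix (Fin 3) (Fin 3) (MvPolynomial (Fin 3 × Fin m) (ZMod p))) (Matrix.of fun i j => MvPolynomial.X (i, j))).submatrix id u).det) '' Γ)) ∧
      IsDomain (Localization.Away g) ∧
      (∀ u : Fin 3 → Fin 3 ⊕ Fin m, u ∉ Γ →
        algebraMap (MvPolynomial (Fin 3 × Fin m) (ZMod p) ⧸ Ideal.span ((fun u : Fin 3 → Fin 3 ⊕ Fin m => ((Matrix.fromCols (1 : Matrix (Fin 3) (Fin 3) (MvPolynomial (Fin 3 × Fin m) (ZMod p))) (Matrix.of fun i j => MvPolynomial.X (i, j))).submatrix id u).det) '' Γ)) (Localization.Away g)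
          (Ideal.Quotient.mk (Ideal.span ((fun u : Fin 3 → Fin 3 ⊕ Fin m => ((Matrix.fromCols (1 : Matrix (Fin 3) (Fin 3) (MvPolynomial (Fin 3 × Fin m) (ZMod p))) (Matrix.of fun i j => MvPolynomial.X (i, j))).submatrix id u).det) '' Γ))
            ((Matrix.fromCols (1 : Matrix (Fin 3) (Fin 3) (MvPolynomial (Fin 3 × Fin m) (ZMod p))) (Matrix.of fun i j => MvPolynomial.X (i, j))).submatrix id u).det) ≠ 0) ∧
      ¬ topologicalKrullDim (Spec (.of (Localization.Away g))) ≤ 1 ∧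
      IsClosed ({w} : Set (Spec (.of (Localization.Away g)))) ∧
      ¬ IsRegularLocalRing ((Spec (.of (Localization.Away g))).presheaf.stalk w) := by
  haveI : Fact (Nat.Prime 3) := ⟨Nat.prime_three⟩
  obtain ⟨h₁, h₂, h₃, -, h₅⟩ := residue_hypotheses 3 (by decide)
  obtain ⟨w, hmax, hw⟩ :=
    exists_isMaximal_not_isRegularLocalRing_chart (K := ZMod 3) (two_ne_zero_zmod 3 (by decide))
  refine ⟨3, Nat.prime_three, 4, _, Ideal.Quotient.mk _ (X (0, 0)), w, h₁, h₂, h₃,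
    fun h => h₅ (h.trans (by norm_num)),
    (PrimeSpectrum.isClosed_singleton_iff_isMaximal w).mpr hmax,
    not_isRegularLocalRing_stalk_Spec w hw⟩

end Summit.ResolutionOfSingularities.ResolutionOfSingularities.Theorems.MatroidCellRes

end
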